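import Literature.MathematicalPhysics.QuantumFieldTheory.ConformalBootstrap3D.PointKernelK34v2Data
import Literature.MathematicalPhysics.QuantumFieldTheory.ConformalBootstrap3D.PointKernelParts

/-!
# K34v2 certificate, kernel part file P41: one-cell head segments 151, 152 in level ranges

The head cells whose kernel evaluation exceeds one `decide` are one-cell segments of `hsegsK34v2`; each is
checked by `PCert.hPartSideOK` (side conditions) and `PCert.hPartOK` per level range `[n_lo, n_lo + count)`
against an integer claim, the claims summing to `≥ 0` (`PointKernel.partsOK`); soundness is
`PCert.hParts_sound` (`PointKernelParts`).  The part files `P1, P2, …` are mutually independent (each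
imports only the data file); the ranges of one cell may span several of them, and the per-cell
conclusions `hparts_i` / `hcell_i` of those cells are assembled in `PointKernelK34v2.lean`.
Estimated kernel time 251 s.
-/

set_option maxRecDepth 100000
set_option maxHeartbeats 0

namespace Literature.MathematicalPhysics.QuantumFieldTheory.ConformalBootstrap3D.PointKernelK34v2

open Literature.MathematicalPhysics.QuantumFieldTheory.ConformalBootstrap3D.PointKernel

/-- levels `[40, 49)` of segment 151: partial lower sum `≥` claim. [folklore] -/
theorem part_151_2 : certK34v2.hPartOK (PCert.segAt hsegsK34v2 151) JHK34v2 40 9 (6528490372251405806170668277235285993) = true := by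
  decide +kernel

/-- levels `[49, 56)` of segment 151: partial lower sum `≥` claim. [folklore] -/
theorem part_151_3 : certK34v2.hPartOK (PCert.segAt hsegsK34v2 151) JHK34v2 49 7 (2073727279173302262254156848372871537) = true := by
  decide +kernel

/-- levels `[56, 61)` of segment 151: partial lower sum `≥` claim. [folklore] -/
theorem part_151_4 : certK34v2.hPartOK (PCert.segAt hsegsK34v2 151) JHK34v2 56 5 (705625664099283054654136675904063617) = true := by
  decide +kernel

/-- levels `[61, 65)` of segment 151: partial lower sum `≥` claim. [folklore] -/
theorem part_151_5 : certK34v2.hPartOK (PCert.segAt hsegsK34v2 151) JHK34v2 61 4 (300601428589255354388027302154945024) = true := by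
  decide +kernel

/-- one-cell segment 152 (row 6, cell `[7173/1024, 3587/512]`, chord, `n_F = 72`,
10 level ranges): side conditions. [folklore] -/
theorem pside_152 : certK34v2.hPartSideOK (PCert.segAt hsegsK34v2 152) JHK34v2 = true := by
  decide +kernel

/-- its level ranges `(n_lo, count, claim)`. [folklore] -/
def parts_152 : List (ℕ × ℕ × ℤ) := [(0, 25, -42647051555457879583562855809961910934), (25, 11, 27157796890086897507862298704990845509), (36, 8, 9049603949153404426423706736810012945), (44, 6, 3260876002268490239146142350673857115), (50, 5, 1483458844331426442743770159474506835), (55, 5, 849229990558211160228163851320293212), (60, 4, 405114715685495591989958434537121571), (64, 4, 255893250087994645216968548375884782), (68, 3, 125515113024576215239547991446420157), (71, 2, 59562800261383354712299032332968809)]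

/-- the ranges tile `[0, n_F]` and the claims sum to `≥ 0`. [folklore] -/
theorem pcov_152 : PointKernel.partsOK 72 parts_152 = true := by
  decide +kernel

end Literature.MathematicalPhysics.QuantumFieldTheory.ConformalBootstrap3D.PointKernelK34v2
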